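import Literature.MathematicalPhysics.QuantumFieldTheory.Balaban1983to89.Node00.N24GlueStage13CCoPR
import Literature.MathematicalPhysics.QuantumFieldTheory.Balaban1983to89.B16NodeKnitRecord13CoPR
import Literature.MathematicalPhysics.QuantumFieldTheory.Balaban1983to89.Node00.N24NodesWindowStage12C

/-!
# NODE N24 · (B2), THE THIRTEEN-NODE CONJUNCTION AND THE CLOSER'S POINTED FORM AT NODE 00's bg-free Co STAGE-13 RECORD (print's background, director-ym №152 (β)) `IsRecordOfRecord₁₃CCoPR` WITH N11 ∧ N13 ENTERED BY NAME
# (`B16NodeKnitRecord13CoPR` ∕ `B16NodeKnitRecord13CoPR`: [Balaban1989LargeFieldII] Thm 1 + (0.1) at the Stage-13 objects under `Provisos₁₃CoPR`, and seat dag-n11-a's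
# construction-generic Theorem-1 knit with the start `sLaw₁₃CoPR_zero`), N09 a by-name binder ∕ its Theorem-3 member displayed — module 38 (‴ `N24KnitStage13All` p489346, ⁗
# `N24KnitStage13AllSep` p504928) STATED ONCE OVER `Provisos₁₃CoPR ∕ datumOfRecord₁₃CoPR ∕ IsRecordOfRecord₁₃CCoPR`

TRACK A (YM-PLAN §2d, node N24 of 28 = binder B2 `hB : B16.EndStatementBPrinted D.C`), seat `pub-ymgap-dag-n24-c` (R134 fan-out seat, strategy s2; gen 5).
THE v1.6 `CoPR` EDITION (director-ym №169 ∕ №174 after FINDING №8 — node00-def-T LOCATED-8: the 𝐓-residual slot `Zt : (K : ℕ) → …` was RUN-BLIND; H1 = `structure Stage13RParams extends Stage13Params` + the RUN-INDEXED residual `Zr : (p : B12.RunParams) → TkResidualW … p.K`, core key `Stage13RParams.Provisos₁₃CoPR` (= `Provisos₁₃Core`'s rows at `θ.toStage13Params` + `zrLaws ∕ zrLocal`), every background-free object read at `θ.toStage13Params`; node00-def-T FILE 25 `Node00/Record13CoPR.lean` + 26T `Node00/Record13SepCoPR.lean`, keymap `keymap-CoPR.tsv`; = this seat's LANDED v1.5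 CoP edition under that keymap, proofs verbatim) — RECORD 13 AT PRINT's BACKGROUND `UbgOfRecord₁₃CoPR` (node00-def-R `UbgMSCoPOfRecord` over [15] p.277's Ω₀ = Ω₁ + M₁-collar, FILE 22′ p519921) WITH PRINT's
ζ0-ONLY 𝐓-WEIGHTS `WtOfRecord₁₃R` (node00-def-T 12a″ `TkWeightsOfRecordP` p519608) — director-ym LINE №152 (β) + №160 F7 ∕ №162 (y) after FINDING №7 (n11-d `not_tLaw₁₃_zero`:
on ≤ v1.4 the (S1ᵀ) slot `SLaw → TLaw` of every hT-face was unsatisfiable at k = 0 via 12a's `chiRegW` on `Ω₁ᶜ`; F7 re-ranges that weight — satisfiability at k = 0 is NOT asserted here);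
node00-def-T FILE 25 `Node00/Record13CoPR.lean` p529474, KEY = `keymap-CoPR.tsv`; = this seat's LANDED v1.5 CoP edition p522217 ∕ p522487 ∕ p523453 ∕ p524607 ∕ p524398 (∕ thin p525276 ∕ p526035 ∕ PinX3HS p529950) under the
keymap, proofs verbatim — AND EDITION-FREE OVER THE PROVISO EDITIONS (def-T ∕ №152 §4 «key ONCE, on Core(Co), where you read no
proviso row»).  N24's Stage-13 surface (modules 37–44: ‴ v1.1-keyed, ⁗ v1.2 `Sep`-keyed, the ⁵ `SepMixed` prestage — all at the tree's former background `UbgOfRecord₁₃`) reads NO proviso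
row of node00-def-T's RECORD 13 except the CORE rows `rstep` ∕ `tstep` (through the datum, and on the live line to feed dag-n11-e's (D) chain and node00-def-K0a's slots lemma); hence
every NON-item-facing theorem is stated ONCE here, over the background-free core key `Stage13RParams.Provisos₁₃CoPR` (UNCHANGED, `Node00/Record13.lean` v1.2 §9) and def-T's Co
objects of record — laws `SLaw₁₃CoPR ∕ TLaw₁₃CoPR`, 𝐑-carrier `VOfRecord₁₃CoPR`, Stage-5 view `Stage13RParams.toStage5₁₃CoPR`, machine core `coreOfRecord₁₃CoPR`, tower ∕ datum
`towerOfRecord₁₃CoPR ∕ datumOfRecord₁₃CoPR (θ) (h : θ.Provisos₁₃CoPR F N)`, the bg-free Co RECORD FAMILY `IsRecordOfRecord₁₃CCoPR` with its pointed form, shadow ∕ transfer block and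
`endStatementBPrinted_of_isRecordOfRecord₁₃CCoPR_of_nodes` (FILE 25; the density `densOfRecord₁₃`, the histories `gOfRecord₁₃`, `betaOfRecord₁₃`, `EOfRecord₁₃`, the (2.9) species
`chiβOfRecord₁₃` and `wilsonBGOfRecord` are background-FREE and unchanged) — and serves EVERY proviso edition E over that background (v1.6 `Provisos₁₃SepCoPR` — def-T FILE 26T
`Node00/Record13SepCoPR.lean` — and its successors) AT `hP.toCore` (def-T's one-way map `Provisos₁₃E.toCore`, record projection `IsRecordOfRecord₁₃CE.toCoPR`; datum bridge
`datumOfRecord₁₃E F N θ h = datumOfRecord₁₃CoPR F N θ h.toCore` by `rfl`).  Only the ITEM-FACING theorems — K1's θ-keyed consequent `∃ θ' (h' : θ'.Provisos₁₃E F N), …` and the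
registered rung bodies concluding `IsRecordOfRecord₁₃CE …` — stay per edition, in ONE thin module per edition whose proofs are the 3-line packagings
`⟨θ, hP, …, <Co engine> … hP.toCore …, window⟩` of the engines below (this seat's `N24ItemsStage13SepCoPR`).  A Co record has NO background ROW (only the background OBJECT in its §2
form): on its own it discharges nothing of (B) — the (B)-side inputs are HYPOTHESES here exactly as in every edition.
A NEW importing module (imports `Node00.N24GlueStage13CCoPR` — the Co engine and sockets —, `B16NodeKnitRecord13CoPR` — N13's Co junction — and module 26's
datum-generic window).  THEOREMS ONLY, def-free, sorry-free, standard axioms.  = module 38 §1–§3 (via its ⁗ edition) under KEY-RULE-21: `θ.Provisos₁₃Sep ↦ θ.Provisos₁₃CoPR` (the background-free key), `datumOfRecord₁₃Sep ↦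
datumOfRecord₁₃CoPR`, `IsRecordOfRecord₁₃CSep ↦ IsRecordOfRecord₁₃CCoPR` (def-T's Co faces `b4 ∕ b5 ∕ b7_main_of_isRecordOfRecord₁₃CCoPR`, `construction_eq_of_isRecordOfRecord₁₃CCoPR`,
`endStatementBPrinted_of_isRecordOfRecord₁₃CCoPR_of_nodes` BY NAME; θ-level `SLaw₁₃CoPR ∕ TLaw₁₃CoPR ∕ sLaw₁₃CoPR_zero ∕ coreOfRecord₁₃CoPR ∕ densOfRecord₁₃ ∕ gOfRecord₁₃ ∕ chiβOfRecord₁₃` and module 36's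
`B16NodeKnitRecord13CoPR` §0's h-free `rOperation_iff_laws₁₃CoPR` (Co twin of module 36's pin reading); N13's θ-pointed junction `B16NodeKnitRecord13CoPR.b16_main_at_record₁₃CoPR` applied AT `hP` itself), own stems `…Sep… ↦ …Co…`, `_sep ↦ _coPR`.

WHAT THIS FILE PROVES (8 theorems).
§1 `N24_at_record₁₃CCoPR_knit_N11_N13_pinned` — (B2) at a Co ₁₃C record: six θ-keyed residual-carrier sockets over `θ.toStage5₁₃CoPR`, **N11 ∧ N13** ← the keyed slot TRIPLE (S1ᵀ) (R₁₃)
   (UV₁₃) (`B16NodeKnitRecord13CoPR.nodes_N11_N13_of_isRecordOfRecord₁₃CCoPR`), **N09** the by-name binder `h09`, β-box; `N24_at_record₁₃CCoPR_knit_N11_N13_of_betaMerged_pinned` (β at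
   the merged β over `(TcanOfRecord, chiFixed29 θ.ν θ.ε₂₉)`).
§2 `N24_nodes₁₃CCoPR_knit_N11_N13_pinned` — `∀ P, Nodes (leavesP w P)` AT THE RECORD'S OWN WORLD from the same list.
§3 `N24_betaBoundsInInterval_of_isRecordOfRecord₁₃CCoPR_of_boxH`; the closer's POINTED form at a world bound to a Core-keyed Co presentation `(θ, hP : θ.Provisos₁₃CoPR F N)`:
   `N24_exists_boundWorld₁₃CoPR`, **`N24_nodes₁₃CoPR_pointed`** (every child at θ's Stage-13 objects; N09 ← own leaf `h09` + its Theorem-3 member `h09T` DISPLAYED; N11 ← (S1ᵀ); N13 ←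
   (R₁₃) `hR` + (UV₁₃) `hUV`), **`N24_endStatementBPrinted₁₃CoPR_pointed`** ((B2) at `(datumOfRecord₁₃CoPR θ hP).C` — at an E-presentation `(θ, h)` this IS (B2) at
   `(datumOfRecord₁₃E θ h).C` by `rfl`, applied at `h.toCore`), `N24_stabilityBR13CoPR_shape_pointed` (`IsRecordOfRecord₁₃CCoPR … w ∧ (B) ∧ window`).

WHICH CHILD BLOCKS AT A Co STAGE-13 PRESENTATION (kernel form, pointed): `hP : θ.Provisos₁₃CoPR` + `Admissible` (every edition's K0-class item yields it at `.toCore`) · the world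
binding · N05 [B8] residual leaf · N06 def-Y's leaf · N07 [B11] leaf · N08 leaf-system form · N09 own Lemma-4 leaf + Theorem-3 member (displayed until the dag-n09 lane's
canonical-transport plug) · N10 B13 socket · N11 (S1ᵀ) at `SLaw₁₃CoPR ∕ TLaw₁₃CoPR` · N12 [IV] leaf · N13 (R₁₃) + (UV₁₃) at `densOfRecord₁₃`, `chiβOfRecord₁₃` · β⁺ ([I] (1.22) p. 264) + `b > 0`
(NODE O, UNPRINTED).
HONEST FRAMING: kernel bookkeeping BY NAME; nothing of Bałaban's asserted; every slot DISPLAYED; N24 COMPOSITE — no discharge, no count moved (5∕27), no stub closed; one finite T⁴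
programme at fixed ε; NOT continuum ∕ ℝ⁴ ∕ OS ∕ mass gap ∕ Clay.
-/

noncomputable section

open scoped Matrix.Norms.L2Operator

namespace Literature.MathematicalPhysics.QuantumFieldTheory.Balaban1983to89.Node00

open DagBinding T4Continuum T4DatumAssembly FlowStepRuns AveragingRT
open FlowStep (BetaLowerH BetaUpperH)
open B14NodeKnitRecord9 (b14_main_at_construction_rhoOfRecord9_along)

variable {F : T4Family} {N : ℕ} [NeZero N] {D : FiniteEpsData F (SU N)} {w : WorldP}

/-! ## §1. (B2) at the Stage-13 record, N11 ∧ N13 by name, N09 a binder -/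

/-- **N24 · (B2) AT THE STAGE-13 RECORD, N11 ∧ N13 ENTERED AT THE RECORD'S OWN PARAMETERS BY NAME** (module 19 ∕ 24's pattern at ₁₃): six θ-keyed residual-carrier sockets
(X-[B8] N05 ∕ Y N06 ∕ Z N07 ∕ X-[B10] N08 ∕ X-B13 N10 ∕ W N12, `N24GlueStage13CCoPR` §0); **N11 ∧ N13** ← the keyed slot triple `slots₁₁₁₃` = (S1ᵀ) «N11's antecedents → ∀ k < K,
SLaw₁₃CoPR k → TLaw₁₃CoPR k» ∧ (R₁₃) «∀ k < K, TLaw₁₃CoPR k → SLaw₁₃CoPR (k+1)» ∧ (UV₁₃) «interval on ]0, w.γ] → ∀ k ≤ K, SLaw₁₃CoPR k → (0.1) pointwise on `densOfRecord₁₃ θ P k` with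
`χ = chiβOfRecord₁₃ θ`, `A^η = wilsonBGOfRecord θ.εbg`, `g_k = gOfRecord₁₃ θ P k`, `e∓ = w.em ∕ w.ep`» (`B16NodeKnitRecord13CoPR.nodes_N11_N13_of_isRecordOfRecord₁₃CCoPR`); **N09** the by-name
binder `h09`; β-box on `D.βfun` over `]0, γ₀]`. [cite: Balaban1989LargeFieldII, Thm 1 p.355, (0.1) pp.355–356, p.387, p.391; Balaban1988Convergent, Thm 1 p.262, Theorem p.245, p.244, (2.18) p.257, Cor. 3 (2.50) p.264; Balaban1987RG1, Thm 3 p.264, (1.22) p.264, (2.9) p.266; Balaban1985RegularSpaces, Thms 2, 4, 8 pp.83–101; Balaban1985BackgroundPropagators, Thms 3.1–3.15 pp.397–432; Balaban1985Variational, Thm 1 p.279; Balaban1985UV3, Thm 1 p.257 + Thm 2 p.272; Balaban1988RG2Cluster, Lemmas 1–3 pp.9, 11, 20; Balaban1989LargeFieldI, Prop. 1 p.194 (bookkeeping over the Stage-13 record)] -/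
theorem N24_at_record₁₃CCoPR_knit_N11_N13_pinned (h : IsRecordOfRecord₁₃CCoPR F N D w) {γ₀ : ℝ} (hγ₀ : w.γ ≤ γ₀)
    (slots₀₅ : ∀ (θ : Stage13RParams F N) (hP : θ.Provisos₁₃CoPR F N), θ.Admissible F N → D = datumOfRecord₁₃CoPR F N θ hP →
      (∀ P, w.up P = upOfRecord₅C F N (θ.toStage5₁₃CoPR F N) P) → ∀ P : B12.RunParams,
        B8LeafR (θ.res.X P).d8 (θ.res.X P).L8 (θ.res.X P).C₂ (θ.res.X P).B₁' (θ.res.X P).B₀' (θ.res.X P).B₁ (θ.res.X P).B₂ (θ.res.X P).c₁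
          (θ.res.X P).inp8 (θ.res.X P).B₀β (θ.res.X P).loc8 (θ.res.X P).fam8R (θ.res.X P).lan8 (θ.res.X P).cub8 (θ.res.X P).toAxial8)
    (slots₀₆ : ∀ (θ : Stage13RParams F N) (hP : θ.Provisos₁₃CoPR F N), θ.Admissible F N → D = datumOfRecord₁₃CoPR F N θ hP →
      (∀ P, w.up P = upOfRecord₅C F N (θ.toStage5₁₃CoPR F N) P) → ∀ P : B12.RunParams, B9LeafX (θ.res.Y P))
    (slots₀₇ : ∀ (θ : Stage13RParams F N) (hP : θ.Provisos₁₃CoPR F N), θ.Admissible F N → D = datumOfRecord₁₃CoPR F N θ hP →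
      (∀ P, w.up P = upOfRecord₅C F N (θ.toStage5₁₃CoPR F N) P) → ∀ P : B12.RunParams, B11Leaf (θ.res.Z P))
    (slots₀₈ : ∀ (θ : Stage13RParams F N) (hP : θ.Provisos₁₃CoPR F N), θ.Admissible F N → D = datumOfRecord₁₃CoPR F N θ hP →
      (∀ P, w.up P = upOfRecord₅C F N (θ.toStage5₁₃CoPR F N) P) → ∀ P : B12.RunParams,
        ∃ (Xc : PrintedCarriersR) (I : Type) (C : B10Assembly.Consts) (T : I → B10.TowerRun),
          Nonempty (∀ i, B10Assembly.LeafSystem C (T i)) ∧ θ.res.X P = Xc.withTowerRuns10 T)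
    (h09 : ∀ P : B12.RunParams, Dag.B12_main (leavesP w P))
    (slots₁₀ : ∀ (θ : Stage13RParams F N) (hP : θ.Provisos₁₃CoPR F N), θ.Admissible F N → D = datumOfRecord₁₃CoPR F N θ hP →
      (∀ P, w.up P = upOfRecord₅C F N (θ.toStage5₁₃CoPR F N) P) → ∀ P : B12.RunParams,
        B9LeafX (θ.res.Y P) →
          (B10.Thm1PrintedCompact (θ.res.X P).runs10 ∧ B10.Thm2Printed (θ.res.X P).runs10) →
            B11Leaf (θ.res.Z P) → B12Sec2to5.Lemma4Printed (θ.res.X P).F12 (θ.res.X P).c12 →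
              B13.Lemma1Printed (θ.res.X P).S13 (θ.res.X P).c13 ∧ B13.Lemma2Printed (θ.res.X P).S13 (θ.res.X P).c13 ∧
                B13.Lemma3Printed (θ.res.X P).S13 (θ.res.X P).c13)
    (slots₁₁₁₃ : ∀ (θ : Stage13RParams F N) (hP : θ.Provisos₁₃CoPR F N), θ.Admissible F N → D = datumOfRecord₁₃CoPR F N θ hP →
      (∀ P, w.up P = upOfRecord₅C F N (θ.toStage5₁₃CoPR F N) P) → ∀ P : B12.RunParams,
        ((leavesP w P).b7 → (leavesP w P).b8 → (leavesP w P).b9 → (leavesP w P).b10 → (leavesP w P).b11 →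
          (leavesP w P).smallCouplings → (leavesP w P).smallFieldInductive → (leavesP w P).flowControl →
            ∀ k, k < P.K → SLaw₁₃CoPR F N θ P k → TLaw₁₃CoPR F N θ P k) ∧
        (∀ k, k < P.K → TLaw₁₃CoPR F N θ P k → SLaw₁₃CoPR F N θ P (k + 1)) ∧
        ((genFlow (betaOfRecord₁₃ F N θ.toStage13Params) P.g0).InInterval w.γ P.K → ∀ k, k ≤ P.K → SLaw₁₃CoPR F N θ P k →
          ∀ U : GaugeField (F.P P.K) k (SU N),
            chiβOfRecord₁₃ F N θ.toStage13Params P.K (gOfRecord₁₃ F N θ.toStage13Params P) k U *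
                  Real.exp (-(1 / (gOfRecord₁₃ F N θ.toStage13Params P k) ^ 2 * wilsonBGOfRecord F N θ.εbg P k U)
                    - w.em (gOfRecord₁₃ F N θ.toStage13Params P k) * (Fintype.card (Site (F.P P.K) k) : ℝ)) ≤ densOfRecord₁₃ F N θ.toStage13Params P k U ∧
            densOfRecord₁₃ F N θ.toStage13Params P k U ≤ Real.exp (w.ep (gOfRecord₁₃ F N θ.toStage13Params P k) * (Fintype.card (Site (F.P P.K) k) : ℝ))))
    (slots₁₂ : ∀ (θ : Stage13RParams F N) (hP : θ.Provisos₁₃CoPR F N), θ.Admissible F N → D = datumOfRecord₁₃CoPR F N θ hP →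
      (∀ P, w.up P = upOfRecord₅C F N (θ.toStage5₁₃CoPR F N) P) → ∀ P : B12.RunParams, B15Leaf (θ.res.W P))
    (hlo : BetaLowerH w.b γ₀ D.βfun) (hhi : BetaUpperH w.βup γ₀ D.βfun) :
    B16.EndStatementBPrinted D.C :=
  have hN := B16NodeKnitRecord13CoPR.nodes_N11_N13_of_isRecordOfRecord₁₃CCoPR h slots₁₁₁₃
  N24_at_record₁₃CCoPR h hγ₀ (N24_b8_main_of_isRecordOfRecord₁₃CCoPR_of_slot h slots₀₅) (N24_b9_main_of_isRecordOfRecord₁₃CCoPR_of_slot h slots₀₆)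
    (N24_b11_main_of_isRecordOfRecord₁₃CCoPR_of_slot h slots₀₇) (N24_b10_main_of_isRecordOfRecord₁₃CCoPR_of_slot h slots₀₈) h09
    (N24_b13_main_of_isRecordOfRecord₁₃CCoPR_of_slot h slots₁₀) (fun P => (hN P).1) (N24_b15_main_of_isRecordOfRecord₁₃CCoPR_of_slot h slots₁₂) (fun P => (hN P).2) hlo hhi

/-- **The same with the β-binders READ AT THE MERGED β over `(TcanOfRecord, chiFixed29 θ.ν θ.ε₂₉)` along the world's own box `]0, w.γ]^{k+1}`** (`N24GlueStage13CCoPR` §2's iffs at the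
presenting `θ`). [cite: Balaban1989LargeFieldII, Thm 1 p.355, (0.1) pp.355–356, p.391; Balaban1987RG1, (0.19) p.255, (1.20)–(1.22) p.264, (2.9) p.266, (2.12)–(2.14) p.268; Balaban1988Convergent, Thm 1 p.262, Theorem p.245, p.244 (bookkeeping over the Stage-13 record)] -/
theorem N24_at_record₁₃CCoPR_knit_N11_N13_of_betaMerged_pinned (h : IsRecordOfRecord₁₃CCoPR F N D w)
    (slots₀₅ : ∀ (θ : Stage13RParams F N) (hP : θ.Provisos₁₃CoPR F N), θ.Admissible F N → D = datumOfRecord₁₃CoPR F N θ hP →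
      (∀ P, w.up P = upOfRecord₅C F N (θ.toStage5₁₃CoPR F N) P) → ∀ P : B12.RunParams,
        B8LeafR (θ.res.X P).d8 (θ.res.X P).L8 (θ.res.X P).C₂ (θ.res.X P).B₁' (θ.res.X P).B₀' (θ.res.X P).B₁ (θ.res.X P).B₂ (θ.res.X P).c₁
          (θ.res.X P).inp8 (θ.res.X P).B₀β (θ.res.X P).loc8 (θ.res.X P).fam8R (θ.res.X P).lan8 (θ.res.X P).cub8 (θ.res.X P).toAxial8)
    (slots₀₆ : ∀ (θ : Stage13RParams F N) (hP : θ.Provisos₁₃CoPR F N), θ.Admissible F N → D = datumOfRecord₁₃CoPR F N θ hP →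
      (∀ P, w.up P = upOfRecord₅C F N (θ.toStage5₁₃CoPR F N) P) → ∀ P : B12.RunParams, B9LeafX (θ.res.Y P))
    (slots₀₇ : ∀ (θ : Stage13RParams F N) (hP : θ.Provisos₁₃CoPR F N), θ.Admissible F N → D = datumOfRecord₁₃CoPR F N θ hP →
      (∀ P, w.up P = upOfRecord₅C F N (θ.toStage5₁₃CoPR F N) P) → ∀ P : B12.RunParams, B11Leaf (θ.res.Z P))
    (slots₀₈ : ∀ (θ : Stage13RParams F N) (hP : θ.Provisos₁₃CoPR F N), θ.Admissible F N → D = datumOfRecord₁₃CoPR F N θ hP →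
      (∀ P, w.up P = upOfRecord₅C F N (θ.toStage5₁₃CoPR F N) P) → ∀ P : B12.RunParams,
        ∃ (Xc : PrintedCarriersR) (I : Type) (C : B10Assembly.Consts) (T : I → B10.TowerRun),
          Nonempty (∀ i, B10Assembly.LeafSystem C (T i)) ∧ θ.res.X P = Xc.withTowerRuns10 T)
    (h09 : ∀ P : B12.RunParams, Dag.B12_main (leavesP w P))
    (slots₁₀ : ∀ (θ : Stage13RParams F N) (hP : θ.Provisos₁₃CoPR F N), θ.Admissible F N → D = datumOfRecord₁₃CoPR F N θ hP →
      (∀ P, w.up P = upOfRecord₅C F N (θ.toStage5₁₃CoPR F N) P) → ∀ P : B12.RunParams,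
        B9LeafX (θ.res.Y P) →
          (B10.Thm1PrintedCompact (θ.res.X P).runs10 ∧ B10.Thm2Printed (θ.res.X P).runs10) →
            B11Leaf (θ.res.Z P) → B12Sec2to5.Lemma4Printed (θ.res.X P).F12 (θ.res.X P).c12 →
              B13.Lemma1Printed (θ.res.X P).S13 (θ.res.X P).c13 ∧ B13.Lemma2Printed (θ.res.X P).S13 (θ.res.X P).c13 ∧
                B13.Lemma3Printed (θ.res.X P).S13 (θ.res.X P).c13)
    (slots₁₁₁₃ : ∀ (θ : Stage13RParams F N) (hP : θ.Provisos₁₃CoPR F N), θ.Admissible F N → D = datumOfRecord₁₃CoPR F N θ hP →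
      (∀ P, w.up P = upOfRecord₅C F N (θ.toStage5₁₃CoPR F N) P) → ∀ P : B12.RunParams,
        ((leavesP w P).b7 → (leavesP w P).b8 → (leavesP w P).b9 → (leavesP w P).b10 → (leavesP w P).b11 →
          (leavesP w P).smallCouplings → (leavesP w P).smallFieldInductive → (leavesP w P).flowControl →
            ∀ k, k < P.K → SLaw₁₃CoPR F N θ P k → TLaw₁₃CoPR F N θ P k) ∧
        (∀ k, k < P.K → TLaw₁₃CoPR F N θ P k → SLaw₁₃CoPR F N θ P (k + 1)) ∧
        ((genFlow (betaOfRecord₁₃ F N θ.toStage13Params) P.g0).InInterval w.γ P.K → ∀ k, k ≤ P.K → SLaw₁₃CoPR F N θ P k →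
          ∀ U : GaugeField (F.P P.K) k (SU N),
            chiβOfRecord₁₃ F N θ.toStage13Params P.K (gOfRecord₁₃ F N θ.toStage13Params P) k U *
                  Real.exp (-(1 / (gOfRecord₁₃ F N θ.toStage13Params P k) ^ 2 * wilsonBGOfRecord F N θ.εbg P k U)
                    - w.em (gOfRecord₁₃ F N θ.toStage13Params P k) * (Fintype.card (Site (F.P P.K) k) : ℝ)) ≤ densOfRecord₁₃ F N θ.toStage13Params P k U ∧
            densOfRecord₁₃ F N θ.toStage13Params P k U ≤ Real.exp (w.ep (gOfRecord₁₃ F N θ.toStage13Params P k) * (Fintype.card (Site (F.P P.K) k) : ℝ))))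
    (slots₁₂ : ∀ (θ : Stage13RParams F N) (hP : θ.Provisos₁₃CoPR F N), θ.Admissible F N → D = datumOfRecord₁₃CoPR F N θ hP →
      (∀ P, w.up P = upOfRecord₅C F N (θ.toStage5₁₃CoPR F N) P) → ∀ P : B12.RunParams, B15Leaf (θ.res.W P))
    (hβm : ∀ (θ : Stage13RParams F N) (hP : θ.Provisos₁₃CoPR F N), θ.Admissible F N → D = datumOfRecord₁₃CoPR F N θ hP → w.γ ≤ θ.γ →
      letI := θ.instVβ₁; letI := θ.instVβ₂; letI := θ.instιβ
      BetaLowerH w.b w.γ (betaMerged F (mergedTermFamilyMatT F N (TcanOfRecord F N) (chiFixed29 F N θ.ν θ.ε₂₉) θ.εbg) θ.ρ8 θ.bV) ∧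
        BetaUpperH w.βup w.γ (betaMerged F (mergedTermFamilyMatT F N (TcanOfRecord F N) (chiFixed29 F N θ.ν θ.ε₂₉) θ.εbg) θ.ρ8 θ.bV)) :
    B16.EndStatementBPrinted D.C := by
  obtain ⟨θ, hP, hθ, hD, -, hγ, -, -⟩ := id h
  obtain ⟨hlo, hhi⟩ := hβm θ hP hθ hD hγ.2
  exact N24_at_record₁₃CCoPR_knit_N11_N13_pinned h le_rfl slots₀₅ slots₀₆ slots₀₇ slots₀₈ h09 slots₁₀ slots₁₁₁₃ slots₁₂
    ((N24_betaLowerH_iff_merged₁₃CoPR θ hP hD hγ.2).mpr hlo) ((N24_betaUpperH_iff_merged₁₃CoPR θ hP hD hγ.2).mpr hhi)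

/-! ## §2. The thirteen nodes AT THE RECORD'S OWN WORLD, N11 ∧ N13 by name, N09 a binder -/

/-- **N24 · THE THIRTEEN DAG NODES AT THE WORLD OF A STAGE-13 RECORD ITSELF** from §1's list without the β-box: N01 ∕ N02 ∕ N04 node00-def-T's transferred theorems, N03
`N24_b6_main_of_isRecordOfRecord₁₃CCoPR`, six θ-keyed sockets, N09 the binder `h09`, N11 ∧ N13 from `slots₁₁₁₃` ⇒ `∀ P, Nodes (leavesP w P)` AT `w` (no exponent re-read: (UV₁₃)
reads the world's own `(e₋, e₊)`). [cite: Balaban1989LargeFieldII, Thm 1 p.355, (0.1) pp.355–356, p.387, p.391; Balaban1988Convergent, Thm 1 p.262, Theorem p.245, p.244, Cor. 3 (2.50) p.264; Balaban1987RG1, Thm 3 p.264; Balaban1985RegularSpaces, Thms 2, 4, 8 pp.83–101; Balaban1985BackgroundPropagators, Thms 3.1–3.15 pp.397–432; Balaban1985Variational, Thm 1 p.279; Balaban1985UV3, Thm 1 p.257 + Thm 2 p.272; Balaban1988RG2Cluster, Lemmas 1–3 pp.9, 11, 20; Balaban1989LargeFieldI, Prop. 1 p.194; Balaban1983RegularityDecay,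 Theorem p.573; Balaban1984PropagatorsI, Props. 1.1–1.2 pp.33–36; Balaban1984PropagatorsII, pp.234–249; Balaban1985Averaging, Props. 1–10 pp.26–50 (bookkeeping over the Stage-13 record)] -/
theorem N24_nodes₁₃CCoPR_knit_N11_N13_pinned (h : IsRecordOfRecord₁₃CCoPR F N D w)
    (slots₀₅ : ∀ (θ : Stage13RParams F N) (hP : θ.Provisos₁₃CoPR F N), θ.Admissible F N → D = datumOfRecord₁₃CoPR F N θ hP →
      (∀ P, w.up P = upOfRecord₅C F N (θ.toStage5₁₃CoPR F N) P) → ∀ P : B12.RunParams,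
        B8LeafR (θ.res.X P).d8 (θ.res.X P).L8 (θ.res.X P).C₂ (θ.res.X P).B₁' (θ.res.X P).B₀' (θ.res.X P).B₁ (θ.res.X P).B₂ (θ.res.X P).c₁
          (θ.res.X P).inp8 (θ.res.X P).B₀β (θ.res.X P).loc8 (θ.res.X P).fam8R (θ.res.X P).lan8 (θ.res.X P).cub8 (θ.res.X P).toAxial8)
    (slots₀₆ : ∀ (θ : Stage13RParams F N) (hP : θ.Provisos₁₃CoPR F N), θ.Admissible F N → D = datumOfRecord₁₃CoPR F N θ hP →
      (∀ P, w.up P = upOfRecord₅C F N (θ.toStage5₁₃CoPR F N) P) → ∀ P : B12.RunParams, B9LeafX (θ.res.Y P))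
    (slots₀₇ : ∀ (θ : Stage13RParams F N) (hP : θ.Provisos₁₃CoPR F N), θ.Admissible F N → D = datumOfRecord₁₃CoPR F N θ hP →
      (∀ P, w.up P = upOfRecord₅C F N (θ.toStage5₁₃CoPR F N) P) → ∀ P : B12.RunParams, B11Leaf (θ.res.Z P))
    (slots₀₈ : ∀ (θ : Stage13RParams F N) (hP : θ.Provisos₁₃CoPR F N), θ.Admissible F N → D = datumOfRecord₁₃CoPR F N θ hP →
      (∀ P, w.up P = upOfRecord₅C F N (θ.toStage5₁₃CoPR F N) P) → ∀ P : B12.RunParams,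
        ∃ (Xc : PrintedCarriersR) (I : Type) (C : B10Assembly.Consts) (T : I → B10.TowerRun),
          Nonempty (∀ i, B10Assembly.LeafSystem C (T i)) ∧ θ.res.X P = Xc.withTowerRuns10 T)
    (h09 : ∀ P : B12.RunParams, Dag.B12_main (leavesP w P))
    (slots₁₀ : ∀ (θ : Stage13RParams F N) (hP : θ.Provisos₁₃CoPR F N), θ.Admissible F N → D = datumOfRecord₁₃CoPR F N θ hP →
      (∀ P, w.up P = upOfRecord₅C F N (θ.toStage5₁₃CoPR F N) P) → ∀ P : B12.RunParams,
        B9LeafX (θ.res.Y P) →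
          (B10.Thm1PrintedCompact (θ.res.X P).runs10 ∧ B10.Thm2Printed (θ.res.X P).runs10) →
            B11Leaf (θ.res.Z P) → B12Sec2to5.Lemma4Printed (θ.res.X P).F12 (θ.res.X P).c12 →
              B13.Lemma1Printed (θ.res.X P).S13 (θ.res.X P).c13 ∧ B13.Lemma2Printed (θ.res.X P).S13 (θ.res.X P).c13 ∧
                B13.Lemma3Printed (θ.res.X P).S13 (θ.res.X P).c13)
    (slots₁₁₁₃ : ∀ (θ : Stage13RParams F N) (hP : θ.Provisos₁₃CoPR F N), θ.Admissible F N → D = datumOfRecord₁₃CoPR F N θ hP →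
      (∀ P, w.up P = upOfRecord₅C F N (θ.toStage5₁₃CoPR F N) P) → ∀ P : B12.RunParams,
        ((leavesP w P).b7 → (leavesP w P).b8 → (leavesP w P).b9 → (leavesP w P).b10 → (leavesP w P).b11 →
          (leavesP w P).smallCouplings → (leavesP w P).smallFieldInductive → (leavesP w P).flowControl →
            ∀ k, k < P.K → SLaw₁₃CoPR F N θ P k → TLaw₁₃CoPR F N θ P k) ∧
        (∀ k, k < P.K → TLaw₁₃CoPR F N θ P k → SLaw₁₃CoPR F N θ P (k + 1)) ∧
        ((genFlow (betaOfRecord₁₃ F N θ.toStage13Params) P.g0).InInterval w.γ P.K → ∀ k, k ≤ P.K → SLaw₁₃CoPR F N θ P k →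
          ∀ U : GaugeField (F.P P.K) k (SU N),
            chiβOfRecord₁₃ F N θ.toStage13Params P.K (gOfRecord₁₃ F N θ.toStage13Params P) k U *
                  Real.exp (-(1 / (gOfRecord₁₃ F N θ.toStage13Params P k) ^ 2 * wilsonBGOfRecord F N θ.εbg P k U)
                    - w.em (gOfRecord₁₃ F N θ.toStage13Params P k) * (Fintype.card (Site (F.P P.K) k) : ℝ)) ≤ densOfRecord₁₃ F N θ.toStage13Params P k U ∧
            densOfRecord₁₃ F N θ.toStage13Params P k U ≤ Real.exp (w.ep (gOfRecord₁₃ F N θ.toStage13Params P k) * (Fintype.card (Site (F.P P.K) k) : ℝ))))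
    (slots₁₂ : ∀ (θ : Stage13RParams F N) (hP : θ.Provisos₁₃CoPR F N), θ.Admissible F N → D = datumOfRecord₁₃CoPR F N θ hP →
      (∀ P, w.up P = upOfRecord₅C F N (θ.toStage5₁₃CoPR F N) P) → ∀ P : B12.RunParams, B15Leaf (θ.res.W P)) :
    ∀ P : B12.RunParams, Nodes (leavesP w P) := fun P =>
  have hN := B16NodeKnitRecord13CoPR.nodes_N11_N13_of_isRecordOfRecord₁₃CCoPR h slots₁₁₁₃
  ⟨b4_main_of_isRecordOfRecord₁₃CCoPR h P, b5_main_of_isRecordOfRecord₁₃CCoPR h P, N24_b6_main_of_isRecordOfRecord₁₃CCoPR h P, b7_main_of_isRecordOfRecord₁₃CCoPR h P,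
    N24_b8_main_of_isRecordOfRecord₁₃CCoPR_of_slot h slots₀₅ P, N24_b9_main_of_isRecordOfRecord₁₃CCoPR_of_slot h slots₀₆ P,
    N24_b10_main_of_isRecordOfRecord₁₃CCoPR_of_slot h slots₀₈ P, N24_b11_main_of_isRecordOfRecord₁₃CCoPR_of_slot h slots₀₇ P, h09 P,
    N24_b13_main_of_isRecordOfRecord₁₃CCoPR_of_slot h slots₁₀ P, (hN P).1, N24_b15_main_of_isRecordOfRecord₁₃CCoPR_of_slot h slots₁₂ P, (hN P).2⟩

/-! ## §3. The interval β-binder at a Stage-13 record; the closer's POINTED form at a world bound to the presentation -/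

/-- **THE INTERVAL β-BINDER AT A STAGE-13 RECORD FROM BOX BOUNDS ON THE β OF RECORD**: `b ≤ D.βfun ≤ β⁺` on `]0, γ₀]^{k+1}` ⇒ `BetaBoundsInInterval w.C.toB12 γ₀ b β⁺`
(`construction_eq_of_isRecordOfRecord₁₃CCoPR`, dictionary clause `D.curries`; module 26's `N24_betaBoundsInInterval_of_isRecordOfRecord₁₂C_of_boxH` at ₁₃).
[cite: Balaban1987RG1, §1 (1.22) p.264; Balaban1989LargeFieldII, Thm 1 p.355 (the binder's consumer; bookkeeping)] -/
theorem N24_betaBoundsInInterval_of_isRecordOfRecord₁₃CCoPR_of_boxH (h : IsRecordOfRecord₁₃CCoPR F N D w) {γ₀ b βup : ℝ}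
    (hlo : BetaLowerH b γ₀ D.βfun) (hhi : BetaUpperH βup γ₀ D.βfun) : BetaBoundsInInterval w.C.toB12 γ₀ b βup := by
  rw [construction_eq_of_isRecordOfRecord₁₃CCoPR h]
  exact DagBinding.betaBoundsInInterval_of_boxBounds D.C.toB12 D.βfun D.curries hlo hhi

/-- **A WORLD BOUND TO `(θ, hP)` (Stage 13) BY node00-def-T's POINTED CLAUSES WITH ANY PRESCRIBED LETTERS** — construction `(datumOfRecord₁₃CoPR θ hP).C`, block size `θ.L`, upstream
blocks the C-binding of record over the Stage-13 view, letters `(γ, e₋, e₊, β⁺, β₀, b, g_R)` as given (`b, β₀ > 0`).  With `0 < γ ≤ θ.γ` it is a Co ₁₃C record (`isRecordOfRecord₁₃CCoPR_of_eq`).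
[cite: Balaban1989LargeFieldII, Thm 1 + (0.1) pp.355–356; Balaban1988Convergent, Cor. 3 (2.50) p.264; Balaban1987RG1, Thm 2 p.259 (the letters' printed homes; bookkeeping)] -/
theorem N24_exists_boundWorld₁₃CoPR (θ : Stage13RParams F N) (hP : θ.Provisos₁₃CoPR F N) (γw : ℝ) (em ep : ℝ → ℝ) (βup : ℝ) {β₀ b : ℝ} (hβ₀ : 0 < β₀) (hb : 0 < b)
    (gR : ℝ) :
    ∃ w : WorldP, w.C = (datumOfRecord₁₃CoPR F N θ hP).C ∧ w.γ = γw ∧ w.L = (θ.L : ℝ) ∧ (∀ P, w.up P = upOfRecord₅C F N (θ.toStage5₁₃CoPR F N) P) ∧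
      w.em = em ∧ w.ep = ep ∧ w.βup = βup ∧ w.β₀ = β₀ ∧ w.b = b ∧ w.gR = gR :=
  ⟨⟨(datumOfRecord₁₃CoPR F N θ hP).C, γw, em, ep, βup, β₀, hβ₀, b, hb, (θ.L : ℝ), by exact_mod_cast θ.hL.2, gR,
      fun P => upOfRecord₅C F N (θ.toStage5₁₃CoPR F N) P⟩,
    rfl, rfl, rfl, fun _ => rfl, rfl, rfl, rfl, rfl, rfl, rfl⟩

/-- **N24 · THE THIRTEEN DAG NODES AT A WORLD BOUND TO THE STAGE-13 PRESENTATION, FROM THE POINTED CHILDREN** (module 27 ∕ 32's recipe at ₁₃): a world `w` bound to `(θ, hP)` IS a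
Co ₁₃C record, and: **N05** `B8LeafR` at `θ.res.X P`; **N06** `B9LeafX (θ.res.Y P)`; **N07** `B11Leaf (θ.res.Z P)`; **N08** leaf-system form of `θ.res.X P`; **N09** own leaf `h09 :
Lemma4Printed (θ.res.X P).F12 (θ.res.X P).c12` + its Theorem-3 member `h09T : smallCouplings → smallFieldInductive` DISPLAYED (`B12NodeKnitRecord8.b12_main_of_leaf_of_thm3Member`;
the dag-n09 lane's canonical-transport re-instantiation of [B11] Thm 1's plug along `gOfRecord₁₃` is NOT in the tree); **N10** B13 socket at the view; **N11** (S1ᵀ) at `SLaw₁₃CoPR ∕ TLaw₁₃CoPR`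
(seat dag-n11-a's construction-generic theorem, start `sLaw₁₃CoPR_zero`, 𝐑 from the node's own antecedent through `rOperation_iff_laws₁₃CoPR`); **N12** `B15Leaf (θ.res.W P)`; **N13** (R₁₃)
`hR` + (UV₁₃) `hUV` (`B16NodeKnitRecord13CoPR.b16_main_at_record₁₃CoPR` at `hP.toCore`); N01 ∕ N02 ∕ N04 node00-def-T's transferred theorems, N03 `N24_b6_main_of_isRecordOfRecord₁₃CCoPR`.  THE HYPOTHESIS LIST IS
«WHICH CHILD BLOCKS `stub_nodes` AT STAGE 13» IN THE CLOSER'S FORM. [cite: Balaban1989LargeFieldII, Thm 1 p.355, (0.1) pp.355–356, p.387, p.391; Balaban1988Convergent, Thm 1 p.262, Theorem p.245, p.244, (2.18) p.257, Cor. 3 (2.50) p.264; Balaban1987RG1, Thm 1 p.259, Thm 3 p.264, Lemma 4 (3.53) p.280, (2.9) p.266; Balaban1985RegularSpaces, Thms 2, 4, 8 pp.83–101; Balaban1985BackgroundPropagators, Thms 3.1–3.15 pp.397–432; Balaban1985Variational, Thm 1 p.279; Balaban1985UV3, Thm 1 p.257 + Thm 2 p.272; Balaban1988RG2Cluster, Lemmas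 1–3 pp.9, 11, 20; Balaban1989LargeFieldI, Prop. 1 p.194 (node bookkeeping at the presentation's own objects)] -/
theorem N24_nodes₁₃CoPR_pointed (θ : Stage13RParams F N) (hP : θ.Provisos₁₃CoPR F N) (hθ : θ.Admissible F N) (w : WorldP)
    (hC : w.C = (datumOfRecord₁₃CoPR F N θ hP).C) (hγ : 0 < w.γ ∧ w.γ ≤ θ.γ) (hL : w.L = (θ.L : ℝ))
    (hup : ∀ P, w.up P = upOfRecord₅C F N (θ.toStage5₁₃CoPR F N) P)
    (h05 : ∀ P : B12.RunParams,
      B8LeafR (θ.res.X P).d8 (θ.res.X P).L8 (θ.res.X P).C₂ (θ.res.X P).B₁' (θ.res.X P).B₀' (θ.res.X P).B₁ (θ.res.X P).B₂ (θ.res.X P).c₁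
        (θ.res.X P).inp8 (θ.res.X P).B₀β (θ.res.X P).loc8 (θ.res.X P).fam8R (θ.res.X P).lan8 (θ.res.X P).cub8 (θ.res.X P).toAxial8)
    (h06 : ∀ P : B12.RunParams, B9LeafX (θ.res.Y P))
    (h07 : ∀ P : B12.RunParams, B11Leaf (θ.res.Z P))
    (h08 : ∀ P : B12.RunParams, ∃ (Xc : PrintedCarriersR) (I : Type) (C : B10Assembly.Consts) (T : I → B10.TowerRun),
      Nonempty (∀ i, B10Assembly.LeafSystem C (T i)) ∧ θ.res.X P = Xc.withTowerRuns10 T)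
    (h09 : ∀ P : B12.RunParams, B12Sec2to5.Lemma4Printed (θ.res.X P).F12 (θ.res.X P).c12)
    (h09T : ∀ P : B12.RunParams, (leavesP w P).smallCouplings → (leavesP w P).smallFieldInductive)
    (h10 : ∀ P : B12.RunParams, B9LeafX (θ.res.Y P) →
      (B10.Thm1PrintedCompact (θ.res.X P).runs10 ∧ B10.Thm2Printed (θ.res.X P).runs10) →
        B11Leaf (θ.res.Z P) → B12Sec2to5.Lemma4Printed (θ.res.X P).F12 (θ.res.X P).c12 →
          B13.Lemma1Printed (θ.res.X P).S13 (θ.res.X P).c13 ∧ B13.Lemma2Printed (θ.res.X P).S13 (θ.res.X P).c13 ∧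
            B13.Lemma3Printed (θ.res.X P).S13 (θ.res.X P).c13)
    (h11 : ∀ P : B12.RunParams, (leavesP w P).b7 → (leavesP w P).b8 → (leavesP w P).b9 → (leavesP w P).b10 → (leavesP w P).b11 →
      (leavesP w P).smallCouplings → (leavesP w P).smallFieldInductive → (leavesP w P).flowControl →
        ∀ k, k < P.K → SLaw₁₃CoPR F N θ P k → TLaw₁₃CoPR F N θ P k)
    (h12 : ∀ P : B12.RunParams, B15Leaf (θ.res.W P))
    (hR : ∀ (P : B12.RunParams) (k : ℕ), k < P.K → TLaw₁₃CoPR F N θ P k → SLaw₁₃CoPR F N θ P (k + 1))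
    (hUV : ∀ P : B12.RunParams, (genFlow (betaOfRecord₁₃ F N θ.toStage13Params) P.g0).InInterval w.γ P.K → ∀ k, k ≤ P.K → SLaw₁₃CoPR F N θ P k →
      ∀ U : GaugeField (F.P P.K) k (SU N),
        chiβOfRecord₁₃ F N θ.toStage13Params P.K (gOfRecord₁₃ F N θ.toStage13Params P) k U *
              Real.exp (-(1 / (gOfRecord₁₃ F N θ.toStage13Params P k) ^ 2 * wilsonBGOfRecord F N θ.εbg P k U)
                - w.em (gOfRecord₁₃ F N θ.toStage13Params P k) * (Fintype.card (Site (F.P P.K) k) : ℝ)) ≤ densOfRecord₁₃ F N θ.toStage13Params P k U ∧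
        densOfRecord₁₃ F N θ.toStage13Params P k U ≤ Real.exp (w.ep (gOfRecord₁₃ F N θ.toStage13Params P k) * (Fintype.card (Site (F.P P.K) k) : ℝ))) :
    IsRecordOfRecord₁₃CCoPR F N (datumOfRecord₁₃CoPR F N θ hP) w ∧ ∀ P : B12.RunParams, Nodes (leavesP w P) := by
  have hrec : IsRecordOfRecord₁₃CCoPR F N (datumOfRecord₁₃CoPR F N θ hP) w := ⟨θ, hP, hθ, rfl, hC, hγ, hL, hup⟩
  refine ⟨hrec, fun P => ?_⟩
  have hl := B11LeafUnpinnedRecord.upOfRecord₅C_b8_b9_b11 (θ.toStage5₁₃CoPR F N) P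
  have h8 : (w.up P).b8 := by rw [hup P]; exact hl.1.2 (h05 P)
  have h9 : (w.up P).b9 := by rw [hup P]; exact hl.2.1.2 (h06 P)
  have h15 : (w.up P).rBasicStep := by
    rw [hup P]; exact (B15LeafKnitRecord7.rBasicStep_upOfRecord₅C_iff (θ.toStage5₁₃CoPR F N) P).2 (h12 P)
  have h12leaf : (leavesP w P).b12 := by
    show (w.up P).b12
    rw [hup P]; exact h09 P
  obtain ⟨Xc, I, C, T, ⟨S⟩, hX⟩ := h08 P
  exact ⟨b4_main_of_isRecordOfRecord₁₃CCoPR hrec P, b5_main_of_isRecordOfRecord₁₃CCoPR hrec P, N24_b6_main_of_isRecordOfRecord₁₃CCoPR hrec P,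
    b7_main_of_isRecordOfRecord₁₃CCoPR hrec P, B8LeafKnit.b8_main_of_leaf w P h8, fun _ _ _ _ => h9,
    B10LeafUnpinnedRecord5C.b10_main_of_upOfRecord₅C_of_leafSystems (θ.toStage5₁₃CoPR F N) (hup P) Xc S hX,
    B11LeafUnpinnedRecord.b11_main_of_upOfRecord₅C_of_b11Leaf (θ.toStage5₁₃CoPR F N) P (hup P) (h07 P),
    B12NodeKnitRecord8.b12_main_of_leaf_of_thm3Member h12leaf (h09T P),
    B13NodeKnitRecord5C.b13_main_at_stage5ParamsC F N (θ.toStage5₁₃CoPR F N) w P (hup P) (h10 P),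
    b14_main_at_construction_rhoOfRecord9_along F N (coreOfRecord₁₃CoPR F N θ) w P θ.ν θ.τ9 (EOfRecord₁₃ F N θ.toStage13Params) (wOfRecord₉ F N θ.toStage9Params) θ.ppSel
      (gOfRecord₁₃ F N θ.toStage13Params) (fun p k _ => SLaw₁₃CoPR F N θ p k) (fun p k _ => TLaw₁₃CoPR F N θ p k) (hC.trans (datumOfRecord₁₃CoPR_C F N θ hP))
      (fun _ _ => Iff.rfl) (fun _ => sLaw₁₃CoPR_zero F N θ P) (h11 P) (fun hrop => (B16NodeKnitRecord13CoPR.rOperation_iff_laws₁₃CoPR F N θ w P (hup P)).1 hrop),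
    B15LeafKnit.b15_main_of_up (U := w.up P) rfl h15,
    B16NodeKnitRecord13CoPR.b16_main_at_record₁₃CoPR F N θ w P hP hC (hup P) (hR P) le_rfl (hUV P)⟩

/-- **N24 · (B2) AT THE STAGE-13 PRESENTATION'S DATUM FROM THE POINTED CHILDREN AND THE β-BOX PAIR**: `B16.EndStatementBPrinted (datumOfRecord₁₃CoPR F N θ hP).C` — §3's nodes at the bound
world, the interval β-binder from the box pair, node00-def-T's END headline `endStatementBPrinted_of_isRecordOfRecord₁₃CCoPR_of_nodes` (`γ₀ := w.γ`).  COMPOSITE: nothing is discharged.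
[cite: Balaban1989LargeFieldII, Thm 1 p.355, (0.1) pp.355–356, p.391; Balaban1987RG1, (1.22) p.264 (bookkeeping at the presentation's own objects)] -/
theorem N24_endStatementBPrinted₁₃CoPR_pointed (θ : Stage13RParams F N) (hP : θ.Provisos₁₃CoPR F N) (hθ : θ.Admissible F N) (w : WorldP)
    (hC : w.C = (datumOfRecord₁₃CoPR F N θ hP).C) (hγ : 0 < w.γ ∧ w.γ ≤ θ.γ) (hL : w.L = (θ.L : ℝ))
    (hup : ∀ P, w.up P = upOfRecord₅C F N (θ.toStage5₁₃CoPR F N) P)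
    (h05 : ∀ P : B12.RunParams,
      B8LeafR (θ.res.X P).d8 (θ.res.X P).L8 (θ.res.X P).C₂ (θ.res.X P).B₁' (θ.res.X P).B₀' (θ.res.X P).B₁ (θ.res.X P).B₂ (θ.res.X P).c₁
        (θ.res.X P).inp8 (θ.res.X P).B₀β (θ.res.X P).loc8 (θ.res.X P).fam8R (θ.res.X P).lan8 (θ.res.X P).cub8 (θ.res.X P).toAxial8)
    (h06 : ∀ P : B12.RunParams, B9LeafX (θ.res.Y P))
    (h07 : ∀ P : B12.RunParams, B11Leaf (θ.res.Z P))
    (h08 : ∀ P : B12.RunParams, ∃ (Xc : PrintedCarriersR) (I : Type) (C : B10Assembly.Consts) (T : I → B10.TowerRun),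
      Nonempty (∀ i, B10Assembly.LeafSystem C (T i)) ∧ θ.res.X P = Xc.withTowerRuns10 T)
    (h09 : ∀ P : B12.RunParams, B12Sec2to5.Lemma4Printed (θ.res.X P).F12 (θ.res.X P).c12)
    (h09T : ∀ P : B12.RunParams, (leavesP w P).smallCouplings → (leavesP w P).smallFieldInductive)
    (h10 : ∀ P : B12.RunParams, B9LeafX (θ.res.Y P) →
      (B10.Thm1PrintedCompact (θ.res.X P).runs10 ∧ B10.Thm2Printed (θ.res.X P).runs10) →
        B11Leaf (θ.res.Z P) → B12Sec2to5.Lemma4Printed (θ.res.X P).F12 (θ.res.X P).c12 →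
          B13.Lemma1Printed (θ.res.X P).S13 (θ.res.X P).c13 ∧ B13.Lemma2Printed (θ.res.X P).S13 (θ.res.X P).c13 ∧
            B13.Lemma3Printed (θ.res.X P).S13 (θ.res.X P).c13)
    (h11 : ∀ P : B12.RunParams, (leavesP w P).b7 → (leavesP w P).b8 → (leavesP w P).b9 → (leavesP w P).b10 → (leavesP w P).b11 →
      (leavesP w P).smallCouplings → (leavesP w P).smallFieldInductive → (leavesP w P).flowControl →
        ∀ k, k < P.K → SLaw₁₃CoPR F N θ P k → TLaw₁₃CoPR F N θ P k)
    (h12 : ∀ P : B12.RunParams, B15Leaf (θ.res.W P))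
    (hR : ∀ (P : B12.RunParams) (k : ℕ), k < P.K → TLaw₁₃CoPR F N θ P k → SLaw₁₃CoPR F N θ P (k + 1))
    (hUV : ∀ P : B12.RunParams, (genFlow (betaOfRecord₁₃ F N θ.toStage13Params) P.g0).InInterval w.γ P.K → ∀ k, k ≤ P.K → SLaw₁₃CoPR F N θ P k →
      ∀ U : GaugeField (F.P P.K) k (SU N),
        chiβOfRecord₁₃ F N θ.toStage13Params P.K (gOfRecord₁₃ F N θ.toStage13Params P) k U *
              Real.exp (-(1 / (gOfRecord₁₃ F N θ.toStage13Params P k) ^ 2 * wilsonBGOfRecord F N θ.εbg P k U)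
                - w.em (gOfRecord₁₃ F N θ.toStage13Params P k) * (Fintype.card (Site (F.P P.K) k) : ℝ)) ≤ densOfRecord₁₃ F N θ.toStage13Params P k U ∧
        densOfRecord₁₃ F N θ.toStage13Params P k U ≤ Real.exp (w.ep (gOfRecord₁₃ F N θ.toStage13Params P k) * (Fintype.card (Site (F.P P.K) k) : ℝ)))
    (hlo : BetaLowerH w.b w.γ (datumOfRecord₁₃CoPR F N θ hP).βfun) (hhi : BetaUpperH w.βup w.γ (datumOfRecord₁₃CoPR F N θ hP).βfun) :
    B16.EndStatementBPrinted (datumOfRecord₁₃CoPR F N θ hP).C := by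
  obtain ⟨hrec, hn⟩ := N24_nodes₁₃CoPR_pointed θ hP hθ w hC hγ hL hup h05 h06 h07 h08 h09 h09T h10 h11 h12 hR hUV
  exact endStatementBPrinted_of_isRecordOfRecord₁₃CCoPR_of_nodes hrec le_rfl hn (N24_betaBoundsInInterval_of_isRecordOfRecord₁₃CCoPR_of_boxH hrec hlo hhi)

/-- **THE K1-CLASS ₁₃ ITEM'S (D, w)-CONSEQUENT WITNESSED BY THE PRESENTATION AND THE BOUND WORLD** — `IsRecordOfRecord₁₃CCoPR F N (datumOfRecord₁₃CoPR θ hP) w ∧ (B) ∧ window` from the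
pointed children and the β-box pair (the window from `hhi` alone, module 26's datum-generic `N24_window_of_betaUpperH`); the edition's θ-keyed text is packaged from this in its thin module.
COMPOSITE: nothing is discharged. [cite: Balaban1989LargeFieldII, Thm 1 p.355 + p.391; Balaban1987RG1, (0.17)–(0.20) pp.255–256 and (1.22) p.264 (bookkeeping + elementary window)] -/
theorem N24_stabilityBR13CoPR_shape_pointed (θ : Stage13RParams F N) (hP : θ.Provisos₁₃CoPR F N) (hθ : θ.Admissible F N) (w : WorldP)
    (hC : w.C = (datumOfRecord₁₃CoPR F N θ hP).C) (hγ : 0 < w.γ ∧ w.γ ≤ θ.γ) (hL : w.L = (θ.L : ℝ))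
    (hup : ∀ P, w.up P = upOfRecord₅C F N (θ.toStage5₁₃CoPR F N) P)
    (h05 : ∀ P : B12.RunParams,
      B8LeafR (θ.res.X P).d8 (θ.res.X P).L8 (θ.res.X P).C₂ (θ.res.X P).B₁' (θ.res.X P).B₀' (θ.res.X P).B₁ (θ.res.X P).B₂ (θ.res.X P).c₁
        (θ.res.X P).inp8 (θ.res.X P).B₀β (θ.res.X P).loc8 (θ.res.X P).fam8R (θ.res.X P).lan8 (θ.res.X P).cub8 (θ.res.X P).toAxial8)
    (h06 : ∀ P : B12.RunParams, B9LeafX (θ.res.Y P))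
    (h07 : ∀ P : B12.RunParams, B11Leaf (θ.res.Z P))
    (h08 : ∀ P : B12.RunParams, ∃ (Xc : PrintedCarriersR) (I : Type) (C : B10Assembly.Consts) (T : I → B10.TowerRun),
      Nonempty (∀ i, B10Assembly.LeafSystem C (T i)) ∧ θ.res.X P = Xc.withTowerRuns10 T)
    (h09 : ∀ P : B12.RunParams, B12Sec2to5.Lemma4Printed (θ.res.X P).F12 (θ.res.X P).c12)
    (h09T : ∀ P : B12.RunParams, (leavesP w P).smallCouplings → (leavesP w P).smallFieldInductive)
    (h10 : ∀ P : B12.RunParams, B9LeafX (θ.res.Y P) →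
      (B10.Thm1PrintedCompact (θ.res.X P).runs10 ∧ B10.Thm2Printed (θ.res.X P).runs10) →
        B11Leaf (θ.res.Z P) → B12Sec2to5.Lemma4Printed (θ.res.X P).F12 (θ.res.X P).c12 →
          B13.Lemma1Printed (θ.res.X P).S13 (θ.res.X P).c13 ∧ B13.Lemma2Printed (θ.res.X P).S13 (θ.res.X P).c13 ∧
            B13.Lemma3Printed (θ.res.X P).S13 (θ.res.X P).c13)
    (h11 : ∀ P : B12.RunParams, (leavesP w P).b7 → (leavesP w P).b8 → (leavesP w P).b9 → (leavesP w P).b10 → (leavesP w P).b11 →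
      (leavesP w P).smallCouplings → (leavesP w P).smallFieldInductive → (leavesP w P).flowControl →
        ∀ k, k < P.K → SLaw₁₃CoPR F N θ P k → TLaw₁₃CoPR F N θ P k)
    (h12 : ∀ P : B12.RunParams, B15Leaf (θ.res.W P))
    (hR : ∀ (P : B12.RunParams) (k : ℕ), k < P.K → TLaw₁₃CoPR F N θ P k → SLaw₁₃CoPR F N θ P (k + 1))
    (hUV : ∀ P : B12.RunParams, (genFlow (betaOfRecord₁₃ F N θ.toStage13Params) P.g0).InInterval w.γ P.K → ∀ k, k ≤ P.K → SLaw₁₃CoPR F N θ P k →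
      ∀ U : GaugeField (F.P P.K) k (SU N),
        chiβOfRecord₁₃ F N θ.toStage13Params P.K (gOfRecord₁₃ F N θ.toStage13Params P) k U *
              Real.exp (-(1 / (gOfRecord₁₃ F N θ.toStage13Params P k) ^ 2 * wilsonBGOfRecord F N θ.εbg P k U)
                - w.em (gOfRecord₁₃ F N θ.toStage13Params P k) * (Fintype.card (Site (F.P P.K) k) : ℝ)) ≤ densOfRecord₁₃ F N θ.toStage13Params P k U ∧
        densOfRecord₁₃ F N θ.toStage13Params P k U ≤ Real.exp (w.ep (gOfRecord₁₃ F N θ.toStage13Params P k) * (Fintype.card (Site (F.P P.K) k) : ℝ)))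
    (hlo : BetaLowerH w.b w.γ (datumOfRecord₁₃CoPR F N θ hP).βfun) (hhi : BetaUpperH w.βup w.γ (datumOfRecord₁₃CoPR F N θ hP).βfun) :
    IsRecordOfRecord₁₃CCoPR F N (datumOfRecord₁₃CoPR F N θ hP) w ∧ B16.EndStatementBPrinted (datumOfRecord₁₃CoPR F N θ hP).C ∧
      ∃ γ₁ : ℝ, 0 < γ₁ ∧ ∀ γ : ℝ, 0 < γ → γ ≤ γ₁ → ∃ P : B12.RunParams, 1 ≤ P.K ∧ ((datumOfRecord₁₃CoPR F N θ hP).C P).flow.InInterval γ P.K :=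
  ⟨⟨θ, hP, hθ, rfl, hC, hγ, hL, hup⟩,
    N24_endStatementBPrinted₁₃CoPR_pointed θ hP hθ w hC hγ hL hup h05 h06 h07 h08 h09 h09T h10 h11 h12 hR hUV hlo hhi,
    N24_window_of_betaUpperH _ hγ.1 hhi⟩

end Literature.MathematicalPhysics.QuantumFieldTheory.Balaban1983to89.Node00

end
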